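import Summits.BirchSwinnertonDyer.Rank1Residual.P2.CongruentNumberSilentEvenFiveThetaCMTorsion
import Literature.NumberTheory.EllipticCurves.TianYuanZhang2017.CMPointClassFieldBeta
import HarnessLib

/-!
# Cell `bsd-monsky` (typer), route B: C-P2-1 on `𝒮⁻` from the THRICE-REDUCED class-field display ALONE — the offered
# corner (`…_of_cmPointClassFieldDataTorsion_descent (hCF″)`, OFFER-M v1.16) with the inclusion «`(β+1)A[4] ⊆ A[2]`» of
# the `β′`-facts struck as well

HONEST FRAMING (cell `bsd-monsky`, run/shared/lean/pub/bsd-monsky/; README §1): ONE theorem on ONE explicit infinite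
family of quadratic twists of the congruent number curve at the prime `2`; not "BSD for rank ≤ 1", nothing at odd primes;
nothing is booked by this file. The corner of record of route B (referee B ROUND 882, 2026-08-27T18:16Z) is
`congruentSilentEvenFiveBSDTwo_of_cmPointClassFieldDataReduced_descent (hCF′)`; the corner offered in OFFER-M v1.16 is
`congruentSilentEvenFiveBSDTwo_of_cmPointClassFieldDataTorsion_descent (hCF″)`. A third derivability pass
(`Literature/…/TianYuanZhang2017/CMPointClassFieldBeta.lean`) found the inclusion «`(β+1)A[4] ⊆ A[2]`» (`n` even) of the
displayed `β′`-facts — half of the printed identity «`(β+1)A[4] = A[2]`», TYZ p0020 L146 — to be a kernel theorem of the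
displayed «`β` acts on `ℚ(i)` trivially» and the `2`-torsion of `A` (`β` fixes `A[2] = {O, (0,0), (±2i, 0)}`, so `2(βQ + Q) =
β(2Q) + 2Q = 4Q = 0`); `tyz_cmPointClassFieldDataBeta` (`hCF‴`) is `hCF″` without that inclusion, and the named facts are
EQUIVALENT in the kernel (`tyz_cmPointClassFieldDataTorsion_iff_beta`, `tyz_cmPointClassFieldData_iff_beta`). This file is
the corner on the thrice-reduced display: `congruentSilentEvenFiveBSDTwo_of_cmPointClassFieldDataBeta_descent (hCF‴)`, with
the sharper form, clause (a) and the pair form from the same binder (proofs: one-line compositions of the v1.16 corner / its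
twins with `tyz_cmPointClassFieldDataTorsion_of_beta`). Marks of record untouched (route B: NONE). CONDITIONAL on the one
(thrice-reduced) display; nothing asserted; the conjecture `Prop`s stay `@[conjecture]`.
[cite: TianYuanZhang2017, §3.1 (J738–J739), Prop. 3.2 (1)(2)(3), Prop. 3.4, Thm. 3.5 (J741) and its proof (p0020 L106–L165, p0021 L1–L5), Thm. 3.6 (1)(2), Lemma 3.16 (p0017 L98–L113), Lemma 3.18 (p0017 L152–L153), Lemma 3.21 and its proof (J759)]
[cite: Cox2013, Theorem 6.1 (ii) and Theorem 9.18] [cite: SilvermanAEC2009, III.2.3, III.6.4, Prop. X.1.4, Prop. X.4.9, Thm. X.4.2]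
[cite: Miller2011LMS, Def. 1.1 (arXiv:1010.2431 p. 3)]
-/

noncomputable section

open scoped Classical

open WeierstrassCurve Literature.NumberTheory.EllipticCurves
  Literature.NumberTheory.EllipticCurves.TianYuanZhang2017

set_option autoImplicit false

namespace Summit.BirchSwinnertonDyer.Rank1Residual.P2

open Conjectures

/-! ## §1 C-P2-1 on `𝒮⁻` from the thrice-reduced class-field display ALONE -/

/-- **C-P2-1 = Theorem 1.1 on `𝒮⁻` (`ord_{s=1} L(E_{2pq}, s) = 1 ∧ BSD(E_{2pq}, 2)`) from `tyz_cmPointClassFieldDataBeta`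
ALONE** — the v1.16 corner (`…_of_cmPointClassFieldDataTorsion_descent (hCF″)`) with the inclusion «`(β+1)A[4] ⊆ A[2]`» of
the `β′`-facts struck from the displayed hypothesis as well (a kernel theorem of «`β(i) = i`» and the `2`-torsion of `A`);
the `2`-Selmer input is the tree's complete `2`-descent. CONDITIONAL on the one display; nothing asserted.
[cite: TianYuanZhang2017, §1 ((1.1)), Thm. 3.5 and its proof (p0020 L106–p0021 L5), Prop. 3.2, Thm. 3.6, Lemma 3.16, Lemma 3.18]
[cite: Cox2013, Theorem 6.1 (ii) and Theorem 9.18] [cite: SilvermanAEC2009, III.2.3, III.6.4, Prop. X.1.4, Prop. X.4.9, Thm. X.4.2]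
[cite: Miller2011LMS, Def. 1.1 (arXiv:1010.2431 p. 3)] -/
theorem congruentSilentEvenFiveBSDTwo_of_cmPointClassFieldDataBeta_descent
    (hCF : tyz_cmPointClassFieldDataBeta) : CongruentSilentEvenFiveBSDTwo :=
  congruentSilentEvenFiveBSDTwo_of_cmPointClassFieldDataTorsion_descent
    (tyz_cmPointClassFieldDataTorsion_of_beta hCF)

/-! ## §2 The sharper form, clause (a) and the pair form from the thrice-reduced display ALONE -/

/-- **C-P2-1, sharper (`Ш_an`-unit) form, on `𝒮⁻` from `tyz_cmPointClassFieldDataBeta` ALONE.** CONDITIONAL; nothing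
asserted. [cite: TianYuanZhang2017, §1 ((1.1)), Thm. 3.5, Prop. 3.2, Thm. 3.6, Lemma 3.18] [cite: Cox2013, Theorem 6.1 (ii) and Theorem 9.18]
[cite: SilvermanAEC2009, Prop. X.1.4, Prop. X.4.9] -/
theorem congruentSilentEvenFiveOrdTwo_of_cmPointClassFieldDataBeta_descent
    (hCF : tyz_cmPointClassFieldDataBeta) : CongruentSilentEvenFiveOrdTwo :=
  congruentSilentEvenFiveOrdTwo_of_cmPointClassFieldDataTorsion_descent
    (tyz_cmPointClassFieldDataTorsion_of_beta hCF)

/-- **Clause (a) on all of `𝒮⁻` from the thrice-reduced display alone**: `ord_{s=1} L(E_{2pq}, s) = 1`. CONDITIONAL; nothing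
asserted. [cite: TianYuanZhang2017, Thm. 3.5, Prop. 3.2, Thm. 3.6, Lemma 3.18, Lemma 3.21] [cite: Cox2013, Theorem 6.1 (ii) and Theorem 9.18] -/
theorem analyticRank_eq_one_sMinus_of_cmPointClassFieldDataBeta (hCF : tyz_cmPointClassFieldDataBeta)
    {p q : ℕ} (hp : p.Prime) (hq : q.Prime) (hp5 : p % 8 = 5) (hq4 : q % 4 = 3) (hj : jacobiSym p q = -1) :
    (congruentNumberCurve (2 * (p * q))).analyticRank = 1 :=
  analyticRank_eq_one_sMinus_of_cmPointClassFieldDataTorsion (tyz_cmPointClassFieldDataTorsion_of_beta hCF) hp hq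
    hp5 hq4 hj

/-- **Both typed forms of C-P2-1 on `𝒮⁻` from `tyz_cmPointClassFieldDataBeta` ALONE.** CONDITIONAL; nothing asserted.
[cite: TianYuanZhang2017, Thm. 3.5, Prop. 3.2, Thm. 3.6, Lemma 3.18] [cite: Cox2013, Theorem 6.1 (ii) and Theorem 9.18]
[cite: SilvermanAEC2009, Prop. X.1.4, Prop. X.4.9] -/
theorem congruentSilentEvenFive_pair_of_cmPointClassFieldDataBeta_descent
    (hCF : tyz_cmPointClassFieldDataBeta) : CongruentSilentEvenFiveOrdTwo ∧ CongruentSilentEvenFiveBSDTwo :=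
  ⟨congruentSilentEvenFiveOrdTwo_of_cmPointClassFieldDataBeta_descent hCF,
    congruentSilentEvenFiveBSDTwo_of_cmPointClassFieldDataBeta_descent hCF⟩

/-! ## §3 The corners are interchangeable (the displayed facts are equivalent in the kernel) -/

/-- **The twice- and thrice-reduced corners are the same theorem read through equivalent displays**: C-P2-1 follows from
`hCF″` iff it follows from `hCF‴` (`tyz_cmPointClassFieldDataTorsion_iff_beta`). [cite: TianYuanZhang2017, §3, proof of Thm. 3.5 (2)] -/
theorem cmPointClassFieldDataTorsion_imp_bsdTwo_iff_beta_imp_bsdTwo :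
    (tyz_cmPointClassFieldDataTorsion → CongruentSilentEvenFiveBSDTwo) ↔
      (tyz_cmPointClassFieldDataBeta → CongruentSilentEvenFiveBSDTwo) :=
  ⟨fun h hB => h (tyz_cmPointClassFieldDataTorsion_of_beta hB),
    fun h hT => h (tyz_cmPointClassFieldDataBeta_of_torsion hT)⟩

end Summit.BirchSwinnertonDyer.Rank1Residual.P2

end
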